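import Summits.CriticalPhenomena.PercolationContinuityZ3.Theorems.PercShatteringRaceNearLinearTwoClusterDecayStubPairAspectOfTwoArm
import Summits.CriticalPhenomena.PercolationContinuityZ3.Theorems.PercShatteringRaceNearLinearTwoClusterDecayStubAspectOfTwoArmBdryWide
import HarnessLib

/-!
# Crux `PercShatteringRace.NearLinearTwoClusterDecay` (stmt-CriticalPhenomena-5785) — stub F1-wide `stub_pairAspectOfTwoArmWide`

Helper file of the line `pair-decay-long-arms-dense` (§ Point-to-point frontier, the PAIR-form lossy
step with the WIDE connection box); lands with `--supports stmt-CriticalPhenomena-5785` (registered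
frontier stub `stub_pairAspectOfTwoArmWide`).

## Statement

F1 (`stub_pairAspectOfTwoArm`) with the WIDE connection box `Λ_{9n}` (van den Berg–Don's box) in place
of `Λ_{2n}`: for bond percolation on `ℤ³` at a general parameter `p > 0`, a pair-connection lower bound
`P_p(a ↔ b inside Λ_{9n}) ≥ c n^{-e}` on `Λ_n²` (`n ≥ 1`, `e ≥ 0`) and a two-arms exponent `κ > 0`
(`P_p(edgeTwoArms i m) ≤ C m^{-κ}`, `m ≥ 1`) give, for every aspect exponent `A > 1` with
`κ A > 6 + e` and every `ε > 0`, that eventually in `n`, UNIFORMLY over the pair `x, x' ∈ Λ_n`, the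
pair event — `x` and `x'` each joined inside `Λ_N` to `∂ⁱⁿΛ_N` but not to each other inside `Λ_N`,
`N = ⌈n^A⌉` — has probability at most `ε`.

## Proof sketch

Write `N = ⌈n^A⌉₊`, `P = P_p`.  Everything except the middle box is F1's
(`NearLinearTwoClusterDecayPairAspect`, imported):
* for a FIXED pair `x, x' ∈ Λ_n` the pair event of `(Λ_n, Λ_N)` lies in `twoArmsBox n (N − n) x x'`;
  Cerf 2015 Lemma 7.1 (bond, `AKN.real_twoArmsBox_mul_le`) with middle box `Λ_{n+k}`, `k = 8n`
  (connection box `Λ_{9n}`), the division by `δ = c n^{-e}` and the count are F1's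
  `real_pair_le_poly` at middle radius `m = 9n` (stated there for a general `n ≤ m`, `m + 3 ≤ N`):
  `P(pair event) ≤ (1 + 6/p) (18n+3)⁶ · 3C (N − 9n − 2)^{−κ} / (c n^{−e})` once `9n + 3 ≤ N`;
* real analysis: F1's `poly_bound_pair` with `P = 9n` needs `72 n ≤ n^A`, eventually true as `A > 1`
  (V6's `NearLinearTwoClusterDecayAspectBdryWide.eventually_one_le_and_seventyTwo_mul_le`), whence
  `9n + 3 ≤ N` and `N − 9n − 2 ≥ n^A / 2`; collecting the powers (`collect_rpow_pair_wide`, the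
  factor `(9n)⁶` contributing `9⁶`) the bound is `≤ K n^{6 + e − κA} → 0` as `κA > 6 + e`
  (`tendsto_rpow_neg_atTop`), so it is eventually `< ε`.

## References

* R. Cerf, *A lower bound on the two-arms exponent for critical percolation on the lattice*, Ann. Probab. 43
  (2015), §7, Lemma 7.1 and Corollary 7.2 (arXiv:1306.3105 pp. 11–13) [Cerf2015].
* J. van den Berg, H. Don, *A lower bound for point-to-point connection probabilities in critical
  percolation*, Electron. Commun. Probab. 25 (2020) (arXiv:1912.10964), Thm 1 / Cor 2 (the box `Λ_{9n}`)
  [VandenbergDon2020].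
-/

noncomputable section

namespace Summit.CriticalPhenomena.PercolationContinuityZ3.Theorems

namespace NearLinearTwoClusterDecayPairAspectWide

open MeasureTheory Filter Topology
open Literature.Probability.LatticeModels Literature.Probability.Percolation

/-! ## Real analysis at the wide scale -/

/-- **Collecting the powers (wide box, fixed pair)** against the pair-connection lower bound
`δ = c t^{-e}`:
`(7⁶ · 3 · 2^κ q C / (c t^{−e})) · (9t)⁶ (t^A)^{−κ} = (7⁶ · 3 · 2^κ q C 9⁶ / c) · t^{6 + e − κA}`
for `t > 0`. [folklore] -/
theorem collect_rpow_pair_wide {t c e κ A q C : ℝ} (ht : 0 < t) :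
    7 ^ 6 * 3 * 2 ^ κ * q * C / (c * t ^ (-e)) * ((9 * t) ^ (6 : ℕ) * (t ^ A) ^ (-κ)) =
      7 ^ 6 * 3 * 2 ^ κ * q * C * 9 ^ 6 / c * t ^ (6 + e - κ * A) := by
  have e1 : t ^ (-e) = (t ^ e)⁻¹ := Real.rpow_neg ht.le e
  have e2 : (t ^ A) ^ (-κ) = t ^ (-(κ * A)) := by
    rw [← Real.rpow_mul ht.le]; congr 1; ring
  have e3 : t ^ (6 + e - κ * A) = t ^ (6 : ℕ) * t ^ e * t ^ (-(κ * A)) := by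
    rw [sub_eq_add_neg, Real.rpow_add ht, Real.rpow_add ht]
    congr 2
    exact_mod_cast Real.rpow_natCast t 6
  rw [e1, e2, e3]
  simp only [div_eq_mul_inv, mul_inv, inv_inv]
  ring

end NearLinearTwoClusterDecayPairAspectWide

open MeasureTheory Filter Topology
open Literature.Probability.LatticeModels Literature.Probability.Percolation
open NearLinearTwoClusterDecayPairAspect NearLinearTwoClusterDecayAspectBdryWide
  NearLinearTwoClusterDecayPairAspectWide

/-- **Frontier stub F1-wide `stub_pairAspectOfTwoArmWide` of the line `pair-decay-long-arms-dense`**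
(registered; § Point-to-point frontier, the PAIR-form lossy step at a general parameter with the WIDE
connection box): for bond percolation on `ℤ³` at any `p > 0`, a pair-connection lower bound
`P_p(a ↔ b inside Λ_{9n}) ≥ c n^{-e}` on `Λ_n²` (`e ≥ 0`) and a two-arms exponent `κ` give, at every
aspect exponent `A > 1` with `κ A > 6 + e` and every `ε > 0`, eventually in `n` and uniformly over the
FIXED pair `x, x' ∈ Λ_n`, that the pair event of `(Λ_n, Λ_N)`, `N = ⌈n^A⌉₊` (both sites joined inside
`Λ_N` to `∂ⁱⁿΛ_N`, not to each other inside `Λ_N`) has probability `≤ ε` — on lattice configurations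
it forces `twoArmsBox n (N − n) x x'`, then Cerf 2015 Lemma 7.1 (bond, `AKN.real_twoArmsBox_mul_le`)
with middle box `Λ_{9n}` (`k = 8n`, van den Berg–Don's connection box) divided by `δ = c n^{-e}` and
the count `(1 + 6/p)(18n+3)⁶ · 3C (N − 9n − 2)^{−κ} / (c n^{−e}) ≤ K n^{6 + e − κA} → 0` (no pair sum).
[cite: Cerf2015, Lemma 7.1] -/
theorem stub_pairAspectOfTwoArmWide :
    ∀ p : unitInterval, 0 < (p : ℝ) → ∀ e : ℝ, 0 ≤ e →
    (∃ c : ℝ, 0 < c ∧ ∀ n : ℕ, 1 ≤ n → ∀ a ∈ box 3 n, ∀ b ∈ box 3 n,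
      c * (n : ℝ) ^ (-e) ≤
        (bondPercolation (zdGraph 3) p).real (openConnIn (↑(box 3 (9 * n)) : Set (Site 3)) a b)) →
    ∀ κ : ℝ, 0 < κ →
    (∃ C : ℝ, ∀ i : Fin 3, ∀ m : ℕ, 1 ≤ m →
      (bondPercolation (zdGraph 3) p).real (AKN.edgeTwoArms i m) ≤ C * (m : ℝ) ^ (-κ)) →
    ∀ A : ℝ, 1 < A → 6 + e < κ * A →
    ∀ ε : ℝ, 0 < ε → ∀ᶠ n : ℕ in Filter.atTop, ∀ x ∈ box 3 n, ∀ x' ∈ box 3 n,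
      (bondPercolation (zdGraph 3) p).real
        {ω | ∃ y ∈ innerBoundary (zdGraph 3) (box 3 ⌈(n : ℝ) ^ A⌉₊),
          ∃ y' ∈ innerBoundary (zdGraph 3) (box 3 ⌈(n : ℝ) ^ A⌉₊),
            ω ∈ openConnIn ↑(box 3 ⌈(n : ℝ) ^ A⌉₊) x y ∧
            ω ∈ openConnIn ↑(box 3 ⌈(n : ℝ) ^ A⌉₊) x' y' ∧
            ω ∉ openConnIn ↑(box 3 ⌈(n : ℝ) ^ A⌉₊) x x'} ≤ ε := by
  intro p hp0 e _he hW1 κ hκ hTA A hA1 hκA ε hε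
  obtain ⟨c, hc, hW⟩ := hW1
  obtain ⟨C, hC⟩ := hTA
  have hC0 : 0 ≤ C := by
    have h := hC 0 1 le_rfl
    rw [Nat.cast_one, Real.one_rpow, mul_one] at h
    exact measureReal_nonneg.trans h
  obtain ⟨q, hq⟩ : ∃ q : ℝ, q = 1 + 6 / (p : ℝ) := ⟨_, rfl⟩
  have hq0 : 0 ≤ q := by rw [hq]; positivity
  obtain ⟨K, hK⟩ : ∃ K : ℝ, K = 7 ^ 6 * 3 * 2 ^ κ * q * C * 9 ^ 6 / c := ⟨_, rfl⟩
  have hlim : Tendsto (fun n : ℕ => K * (n : ℝ) ^ (6 + e - κ * A)) atTop (𝓝 0) := by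
    have h1 : Tendsto (fun n : ℕ => (n : ℝ) ^ (6 + e - κ * A)) atTop (𝓝 0) := by
      have e' : 6 + e - κ * A = -(κ * A - 6 - e) := by ring
      rw [e']
      exact (tendsto_rpow_neg_atTop (by linarith)).comp tendsto_natCast_atTop_atTop
    simpa only [mul_zero] using h1.const_mul K
  have hevε : ∀ᶠ n : ℕ in atTop, K * (n : ℝ) ^ (6 + e - κ * A) < ε := (tendsto_order.1 hlim).2 ε hε
  -- at a good scale `n` (`1 ≤ n`, `72 n ≤ n^A ≤ N`, V6's `eventually_one_le_and_seventyTwo_mul_le`),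
  -- whence `9n + 3 ≤ N` and `N − 9n − 2 ≥ n^A / 2`
  filter_upwards [eventually_one_le_and_seventyTwo_mul_le hA1, hevε] with n ⟨hn1, h72⟩ hnε x hx x' hx'
  have hU1 : (1 : ℝ) ≤ n := Nat.one_le_cast.2 hn1
  have hU0 : (0 : ℝ) < n := by linarith
  have hδ : 0 < c * (n : ℝ) ^ (-e) := mul_pos hc (Real.rpow_pos_of_pos hU0 _)
  have hmr : ((9 * n : ℕ) : ℝ) = 9 * (n : ℝ) := by push_cast; ring
  have hM1 : (n : ℝ) ^ A ≤ (⌈(n : ℝ) ^ A⌉₊ : ℕ) := Nat.le_ceil _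
  have hmM : 9 * n + 3 ≤ ⌈(n : ℝ) ^ A⌉₊ := by
    have h : ((9 * n : ℕ) : ℝ) + 3 ≤ (⌈(n : ℝ) ^ A⌉₊ : ℕ) := by rw [hmr]; linarith
    exact_mod_cast h
  refine le_trans ?_ hnε.le
  calc (bondPercolation (zdGraph 3) p).real
        {ω | ∃ y ∈ innerBoundary (zdGraph 3) (box 3 ⌈(n : ℝ) ^ A⌉₊),
          ∃ y' ∈ innerBoundary (zdGraph 3) (box 3 ⌈(n : ℝ) ^ A⌉₊),
            ω ∈ openConnIn ↑(box 3 ⌈(n : ℝ) ^ A⌉₊) x y ∧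
            ω ∈ openConnIn ↑(box 3 ⌈(n : ℝ) ^ A⌉₊) x' y' ∧
            ω ∉ openConnIn ↑(box 3 ⌈(n : ℝ) ^ A⌉₊) x x'}
      ≤ (1 + 6 / (p : ℝ)) * (2 * ((9 * n : ℕ) : ℝ) + 3) ^ 6 *
            (3 * C * (((⌈(n : ℝ) ^ A⌉₊ : ℕ) : ℝ) - ((9 * n : ℕ) : ℝ) - 2) ^ (-κ)) /
          (c * (n : ℝ) ^ (-e)) :=
        real_pair_le_poly p hp0 hδ hC (by omega) hmM hx hx' (hW n hn1 x hx x' hx')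
    _ ≤ 7 ^ 6 * 3 * 2 ^ κ * q * C / (c * (n : ℝ) ^ (-e)) *
          ((9 * (n : ℝ)) ^ (6 : ℕ) * ((n : ℝ) ^ A) ^ (-κ)) := by
        rw [hq]
        exact poly_bound_pair (by linarith) hmr.ge (by rw [hmr]; linarith) hM1 (by linarith)
          (hq ▸ hq0) hC0 hδ hκ.le
    _ = K * (n : ℝ) ^ (6 + e - κ * A) := by rw [hK]; exact collect_rpow_pair_wide hU0

end Summit.CriticalPhenomena.PercolationContinuityZ3.Theorems
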